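import Summits.CriticalPhenomena.PercolationContinuityZ3.Theorems.PercNearOneGluingNoHeavyQuantRootReduction
import Summits.CriticalPhenomena.PercolationContinuityZ3.Theorems.PercNearOneGluingNoHeavyQuantIndepBlobLowFloor
import HarnessLib

/-!
# QUANT lane R8, FAR on general trees — Conjecture DIB\* (discounted independent blobs) TYPED, its floor-`≤ 1/3` third
# discharged, and the conditional root row `DEC-certificate ∧ DIB* ⟹ FAR at the root` (T-RED/T-DIB of README V185)

builds on p205010 (kernel theorem, internal audit signed; external expert review pending)

Statement + support file (`--supports stmt-CriticalPhenomena-4575`), QUANT lane typer seat prim-quant-stmt (gen 17), rung R8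
of `run/shared/lean/prim/quant/LADDER.md`.  One `Prop`-valued predicate (`DIBWith`) and TWO named OPEN rows (`@[conjecture]` `DIBStar`, `DIBPsi`),
theorems otherwise; no sorries, standard axioms.  Companion of `…QuantRootReduction.lean` (same seat: the root model `RTAIL`, two-point components,
the identity `RTAIL = Σ_σ (Πλ)·TERM_σ`, the heavy + sure row).

**Conjecture DIB\*** (prim-quant-census-2 g49, `ARCH-TREES-G49.md` §3; adopted as the single probabilistic ingredient of the
R8 architecture of record by the gen-15 lead, README V185).  Independent blobs `k` with sizes `a k ∈ ℕ` and gates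
`g k ∈ [0,1]`, `N = Σ_{k open} a k`, floor `x`, layer `j`.  A blob is LIGHT if `g k < x`; light blobs are assumed to have
`a k ≤ j`.  CREDIT: `a k·g k` for a heavy blob, `a k·(g k − x²)/(1 − x)` for a light one (zero at `g = x²`, negative below).
**If the total credit exceeds `2j` then `P(N ≥ j+1) ≥ x`.**  Without light blobs this is `Quant.IndepBlob.far_indepBlob`
(kernel).  Exact evidence (census-2 g49 §3.1, lead g15 LEAD-NOTES-G15 N26 (4), independent engines): exhaustive grids
`(den, #blobs, a_max, j_max) = (12,3,3,4): 86 264`, `(8,4,3,5): 161 260`, `(6,5,2,4): 36 310`, `(8,4,2,4): 30 332` instances,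
random `6 917 + 22 500` near `x → 1`, lead re-check `19 822 + 11 468` + hill-climbs — **0 violations**; the naive discount
`2g − x` is FALSE (`x = 7/8`, `j = 1`, blobs `(1,19/24),(1,3/4),(1,19/24)`: `TAIL/x = 0.999`), and the size hypothesis on light
blobs cannot be dropped (ARCH §1.4 (i)).

* `Quant.IndepBlob.DIBWith x ψ` — the row at floor `x` with light credit rate `ψ` (all blob types in `Type`);
  `Quant.IndepBlob.DIBStar x := DIBWith x κ_x` (Conjecture DIB\*) and `Quant.IndepBlob.DIBPsi x := DIBWith x ψ_x`
  (census-2 g49's weaker DIB-ψ, §6.2, `ψ_x(g) = g − (x − g)/(1 − x)`: "the row the tree programme actually needs");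
  `dibWith_mono` (less light credit = weaker row), `dibPsi_of_dibStar`.
* `Quant.IndepBlob.dibWith_of_nonpos` (`x ≤ 0`, trivial) and **`dibWith_of_le_third` / `dibStar_of_le_third` /
  `dibPsi_of_le_third` (`x ≤ 1/3`, PROVED** from census-1 g14's `IndepBlob.lowFloor_row`: below `1/3` light blobs even count
  at full credit).  OPEN: `1/3 < x < 1`.
* `Quant.RootDec.term_shift`, `term_mono_sizes`, `term_cond` — the sure shift `j ↦ j − s`, monotonicity of a term in the blob
  sizes, conditioning on one blob (rule δ: a light giant splits off at the lower floor `(x − g)/(1 − g)`).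
* `Quant.RootDec.term_ge_of_dibWith` — the row with a sure part: light sizes `≤ j − s`, `2j < 2s + Σ credit ⟹ TERM ≥ x`.
* `Quant.RootDec.term_ge_of_dibWith_capped` — the same with light giants SHRUNK to size `j − s` (dropped when their credit
  rate is `≤ 0`): EFFECTIVE credit `min(a, j − s)·max(ψ(g), 0)` for light blobs, no size hypothesis (ARCH §2.4 γ).
* `Quant.RootDec.term_ge_of_cantelli` — ε: Cantelli with the term's mean and variance (census-1 g14's `count_cantelli`).
* `Quant.RootDec.rtail_ge_of_decCert` — **R3, THE CONDITIONAL ROOT ROW**: if `DIBWith x ψ` holds and every structure law is a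
  mixture of two-point components such that every genuine term is certified by β (sure mass `≥ j+1`), α (a heavy giant),
  or γ (effective discounted credit `> 2(j − s)`), then `RTAIL ≥ x`.  With `…QuantRootReduction`'s `rtail_ge_of_heavyDec`
  this is ARCH-TREES-G49 §2.5/§8 (F2) "one level: children admissible ⟹ FAR at the root, modulo DIB\*" at the level of laws
  (product form: one decomposition per structure); the feasibility of such certificates for every rooted structure
  (Conjectures LIGHT-DEC / TERM / Φ-CLOSURE, ARCH §4/§6.3/§8) is not asserted here.
* `Quant.RootDec.rtail_update_linear` — linearity of `RTAIL` in ONE structure law: the socket for ARCH's SEQUENTIAL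
  expansion (§2.3: the decomposition of the next structure may depend on the sure mass placed so far), for provers who
  want adaptive certificates rather than the product form of `rtail_ge_of_decCert`.

NOVELTY.  presearch: "small-ball / anti-concentration lower bound `P(X ≥ EX/2) ≥ min gate` for weighted Bernoulli sums with
sub-floor gates discounted" → none (corpus hybrid + vsearch: textbook binomial pages only; galaxy `small ball probability|Feige's
inequality`: Gaussian small deviations, unrelated); nearest published neighbours as recorded for `far_indepBlob`
(`…QuantIndepBlobFar.lean`: Paley–Zygmund, Feige 2006, Jogdeo–Samuels 1968 — other thresholds/constants).  [this work; this
lane's census]; the gluing rows served [cite: KozmaNitzan2024, Conjecture 3 (p. 15)]; product weights [cite: Grimmett1999, §1.3 p. 10].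
-/

namespace Summit.CriticalPhenomena.PercolationContinuityZ3.Theorems

namespace Quant

namespace IndepBlob

open Finset

/-- **The discounted-independent-blob row at floor `x` with light credit rate `ψ`.**  For every finite blob type `ι`, sizes
`a : ι → ℕ`, gates `g : ι → [0,1]` and layer `j : ℕ`: if every LIGHT blob (`g k < x`) has `a k ≤ j` and
`2j < Σ_k a k · (g k if x ≤ g k, else ψ (g k))`, then `x ≤ P(Σ_{k open} a k ≥ j+1)` under the product-Bernoulli weights.
`ψ = κ_x` (`(g − x²)/(1 − x)`) is Conjecture DIB\*, `ψ = ψ_x` (`g − (x − g)/(1 − x)`) is census-2 g49's weaker DIB-ψ (§6.2: the row the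
tree programme actually needs); `dibWith_mono`: less light credit = weaker row. [this work] -/
def DIBWith (x : ℝ) (ψ : ℝ → ℝ) : Prop :=
  ∀ (ι : Type) [Fintype ι] [DecidableEq ι] (a : ι → ℕ) (g : ι → ℝ) (j : ℕ),
    (∀ k, 0 ≤ g k ∧ g k ≤ 1) →
    (∀ k, g k < x → a k ≤ j) →
    (2 * j : ℝ) < ∑ k, (a k : ℝ) * (if x ≤ g k then g k else ψ (g k)) →
    x ≤ ∑ W : Finset ι, (∏ k, if k ∈ W then g k else 1 - g k) * (if j + 1 ≤ ∑ k ∈ W, a k then (1 : ℝ) else 0)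

/-- **Conjecture DIB\* (discounted independent blobs) at floor `x`**: `DIBWith x κ_x`, light credit rate
`κ_x(g) = (g − x²)/(1 − x)` (zero at `g = x²`).  Kernel for `x ≤ 1/3` (`dibStar_of_le_third`) and without light blobs
(`far_indepBlob`); OPEN for `1/3 < x < 1` with light blobs (prim-quant-census-2 g49 ARCH-TREES-G49 §3/§7: 0 violations on
`3 532 574 + 1 086 730` exhaustive exact instances and all random/adversarial runs; the discount `2g − x` is false;
independently re-checked by lead g15 and postcont-1 g53).  builds on p205010 (kernel theorem, internal audit signed; external
expert review pending). [this work] [status: open] -/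
@[conjecture] def DIBStar (x : ℝ) : Prop := DIBWith x (fun g => (g - x ^ 2) / (1 - x))

/-- **Conjecture DIB-ψ at floor `x`** (prim-quant-census-2 g49 ARCH-TREES-G49 §6.2): `DIBWith x ψ_x`, light credit rate
`ψ_x(g) = g − (x − g)/(1 − x)` (zero at the half-odds gate `x/(2 − x)`); implied by DIB\* (`dibPsi_of_dibStar`), and already
sufficient for the tree architecture (§6.2); exhaustive exact census `3 430 636` instances, 0 violations (§7).  Kernel for
`x ≤ 1/3` (`dibPsi_of_le_third`).  builds on p205010 (kernel theorem, internal audit signed; external expert review pending).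
[this work] [status: open] -/
@[conjecture] def DIBPsi (x : ℝ) : Prop := DIBWith x (fun g => g - (x - g) / (1 - x))

/-- Unfolding `DIBStar`. -/
theorem DIBStar.dibWith {x : ℝ} (h : DIBStar x) : DIBWith x (fun g => (g - x ^ 2) / (1 - x)) := h

/-- Unfolding `DIBPsi`. -/
theorem DIBPsi.dibWith {x : ℝ} (h : DIBPsi x) : DIBWith x (fun g => g - (x - g) / (1 - x)) := h

/-- **Monotonicity in the light credit**: if `ψ ≤ ψ'` on the light gates `[0, x)` then the row with `ψ'` implies the row with `ψ`. [this work] -/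
theorem dibWith_mono {x : ℝ} {ψ ψ' : ℝ → ℝ} (hle : ∀ g, 0 ≤ g → g < x → ψ g ≤ ψ' g) (h : DIBWith x ψ') : DIBWith x ψ := by
  intro ι _ _ a g j hg hlight hcredit
  refine h ι a g j hg hlight (hcredit.trans_le (Finset.sum_le_sum fun k _ => mul_le_mul_of_nonneg_left ?_ (Nat.cast_nonneg _)))
  by_cases hk : x ≤ g k
  · rw [if_pos hk, if_pos hk]
  · rw [if_neg hk, if_neg hk]; exact hle (g k) (hg k).1 (not_le.1 hk)

/-- **DIB\* implies DIB-ψ** (`ψ_x ≤ κ_x` on `[0, x]`: `κ_x(g) − ψ_x(g) = x − g`). [this work] -/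
theorem dibPsi_of_dibStar {x : ℝ} (hx1 : x < 1) (h : DIBStar x) : DIBPsi x := by
  refine dibWith_mono (fun g _ hg => ?_) h
  have h1x : (0 : ℝ) < 1 - x := by linarith
  rw [le_div_iff₀ h1x, sub_mul, div_mul_cancel₀ _ h1x.ne']
  nlinarith [mul_nonneg (sub_pos.2 hg).le h1x.le]

/-- The row is trivial at non-positive floors (the tail is non-negative). [this work] -/
theorem dibWith_of_nonpos (x : ℝ) (ψ : ℝ → ℝ) (hx : x ≤ 0) : DIBWith x ψ := by
  intro ι _ _ a g j hg _ _
  refine hx.trans (Finset.sum_nonneg fun W _ => mul_nonneg (bernoulliWeight_nonneg (fun k => (hg k).1) (fun k => (hg k).2) W) ?_)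
  split_ifs <;> norm_num

/-- **The row holds at every floor `x ≤ 1/3` for every light credit `ψ ≤ id`** — by census-1 g14's LOW-FLOOR ROW
`IndepBlob.lowFloor_row`, where sub-floor blobs even count at FULL credit: the credit is at most the mean, light blobs have
`a ≤ j < m/2`, heavy ones have gate `≥ x`. [this work] -/
theorem dibWith_of_le_third (x : ℝ) (ψ : ℝ → ℝ) (hx : x ≤ 1 / 3) (hψ : ∀ g, 0 ≤ g → g < x → ψ g ≤ g) :
    DIBWith x ψ := by
  intro ι _ _ a g j hg hlight hcredit
  -- the credit is at most the mean
  have hκ : ∀ k, (a k : ℝ) * (if x ≤ g k then g k else ψ (g k)) ≤ (a k : ℝ) * g k := by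
    intro k
    refine mul_le_mul_of_nonneg_left ?_ (Nat.cast_nonneg _)
    split_ifs with h
    · exact le_refl _
    · exact hψ (g k) (hg k).1 (not_le.1 h)
  have hm : (2 * j : ℝ) < ∑ k, (a k : ℝ) * g k := hcredit.trans_le (Finset.sum_le_sum fun k _ => hκ k)
  have hgiant : ∀ k, (a k : ℝ) ≤ (∑ i, (a i : ℝ) * g i) / 2 ∨ x ≤ g k := by
    intro k
    by_cases h : g k < x
    · left
      have : (a k : ℝ) ≤ j := Nat.cast_le.2 (hlight k h)
      linarith
    · exact Or.inr (not_lt.1 h)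
  have row := lowFloor_row g (fun k => (a k : ℝ)) (fun k => (hg k).1) (fun k => (hg k).2) (fun k => Nat.cast_nonneg (a k))
    x (j : ℝ) hx (Nat.cast_nonneg j) hm hgiant
  -- complement: `P(N ≥ j+1) = 1 − P(N ≤ j)`
  have hfilt : (Finset.univ : Finset (Finset ι)).filter (fun W => ∑ k ∈ W, (a k : ℝ) ≤ (j : ℝ)) =
      (Finset.univ : Finset (Finset ι)).filter (fun W => ∑ k ∈ W, a k ≤ j) := by
    ext W
    simp only [Finset.mem_filter, Finset.mem_univ, true_and]
    rw [← Nat.cast_sum, Nat.cast_le]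
  rw [hfilt, Finset.sum_filter] at row
  have hsplit : ∑ W : Finset ι, (∏ k, if k ∈ W then g k else 1 - g k) * (if j + 1 ≤ ∑ k ∈ W, a k then (1 : ℝ) else 0) =
      ∑ W : Finset ι, ((∏ k, if k ∈ W then g k else 1 - g k) -
        (if ∑ k ∈ W, a k ≤ j then (∏ k, if k ∈ W then g k else 1 - g k) else 0)) := by
    refine Finset.sum_congr rfl fun W _ => ?_
    by_cases h : ∑ k ∈ W, a k ≤ j
    · rw [if_pos h, if_neg (by omega), mul_zero, sub_self]
    · rw [if_neg h, if_pos (by omega), mul_one, sub_zero]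
  rw [hsplit, Finset.sum_sub_distrib, sum_bernoulliWeight]
  linarith

/-- **DIB\* holds at every floor `x ≤ 1/3`.** [this work] -/
theorem dibStar_of_le_third (x : ℝ) (hx : x ≤ 1 / 3) : DIBStar x := by
  refine dibWith_of_le_third x _ hx fun g hg0 hgx => ?_
  rw [div_le_iff₀ (by linarith)]
  nlinarith [mul_nonneg (hg0.trans hgx.le) (sub_pos.2 hgx).le]

/-- **DIB-ψ holds at every floor `x ≤ 1/3`.** [this work] -/
theorem dibPsi_of_le_third (x : ℝ) (hx : x ≤ 1 / 3) : DIBPsi x := by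
  refine dibWith_of_le_third x _ hx fun g hg0 hgx => ?_
  have : 0 ≤ (x - g) / (1 - x) := div_nonneg (by linarith) (by linarith)
  linarith

end IndepBlob

namespace RootDec

open Finset

variable {κ : Type} [Fintype κ] [DecidableEq κ]

/-- configurations of structure counts bounded by `M` (as in `…QuantRootReduction`) -/
local notation3 "cfg[" M "]" => Fintype.piFinset (fun k : κ => Finset.range ((M : κ → ℕ) k + 1))

/-- the ROOT tail (as in `…QuantRootReduction`) -/
local notation3 "RTAIL[" M ", " μ ", " j "]" =>
  ∑ c ∈ cfg[M], (∏ k, (μ : κ → ℕ → ℝ) k ((c : κ → ℕ) k)) * (if (j : ℕ) + 1 ≤ ∑ k, (c : κ → ℕ) k then (1 : ℝ) else 0)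

/-- the two-point law `{lo, hi; g}` (as in `…QuantRootReduction`) -/
local notation3 "TP[" lo ", " hi ", " g ", " h "]" =>
  (g : ℝ) * (if (h : ℕ) = (hi : ℕ) then (1 : ℝ) else 0) + (1 - (g : ℝ)) * (if (h : ℕ) = (lo : ℕ) then (1 : ℝ) else 0)

/-- product-Bernoulli weight of the set `W` of open blobs (as in `…QuantRootReduction`) -/
local notation3 "wt[" g ", " W "]" => ∏ k, (if k ∈ (W : Finset κ) then (g : κ → ℝ) k else 1 - (g : κ → ℝ) k)

/-- the TERM tail `P(s + Σ_{k open} a k ≥ j+1)` (as in `…QuantRootReduction`) -/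
local notation3 "TERM[" s ", " a ", " g ", " j "]" =>
  ∑ W : Finset κ, wt[g, W] * (if (j : ℕ) + 1 ≤ (s : ℕ) + ∑ k ∈ W, (a : κ → ℕ) k then (1 : ℝ) else 0)


/-! ### 1. Sure shift and monotonicity of a term -/

/-- **The sure shift**: for `s ≤ j`, `TERM[s, a, g, j] = P(Σ_{k open} a k ≥ (j − s) + 1)`. [this work] -/
theorem term_shift (s : ℕ) (a : κ → ℕ) (g : κ → ℝ) (j : ℕ) (hs : s ≤ j) :
    TERM[s, a, g, j] = ∑ W : Finset κ, wt[g, W] * (if (j - s) + 1 ≤ ∑ k ∈ W, a k then (1 : ℝ) else 0) := by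
  refine Finset.sum_congr rfl fun W _ => ?_
  by_cases h : j + 1 ≤ s + ∑ k ∈ W, a k
  · rw [if_pos h, if_pos (by omega)]
  · rw [if_neg h, if_neg (by omega)]

/-- **Shrinking blobs lowers the term**: `a ≤ a'` pointwise ⟹ `TERM[s, a, g, j] ≤ TERM[s, a', g, j]` (gates in `[0,1]`). [this work] -/
theorem term_mono_sizes (s : ℕ) (a a' : κ → ℕ) (g : κ → ℝ) (j : ℕ) (hg : ∀ k, 0 ≤ g k ∧ g k ≤ 1)
    (h : ∀ k, a k ≤ a' k) : TERM[s, a, g, j] ≤ TERM[s, a', g, j] := by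
  refine Finset.sum_le_sum fun W _ => mul_le_mul_of_nonneg_left ?_
    (IndepBlob.bernoulliWeight_nonneg (fun k => (hg k).1) (fun k => (hg k).2) W)
  have hle : ∑ k ∈ W, a k ≤ ∑ k ∈ W, a' k := Finset.sum_le_sum fun k _ => h k
  by_cases h1 : j + 1 ≤ s + ∑ k ∈ W, a k
  · rw [if_pos h1, if_pos (by omega)]
  · rw [if_neg h1]
    split_ifs <;> norm_num

/-! ### 2. Term certificates from DIB\* and from Cantelli -/

/-- **γ — the DIB row with a sure part.**  If `DIBWith x ψ` holds, gates are in `[0,1]`, `x ≤ 1`, every light blob (`g k < x`)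
has `a k ≤ j − s`, and `2j < 2s + Σ_k a k·(g k | ψ (g k))`, then `x ≤ TERM[s, a, g, j]` (the row at layer `j − s`). [this work] -/
theorem term_ge_of_dibWith {x : ℝ} {ψ : ℝ → ℝ} (hD : IndepBlob.DIBWith x ψ) (s : ℕ) (a : κ → ℕ) (g : κ → ℝ) (j : ℕ)
    (hx1 : x ≤ 1) (hg : ∀ k, 0 ≤ g k ∧ g k ≤ 1) (hlight : ∀ k, g k < x → a k ≤ j - s)
    (hbudget : (2 * j : ℝ) < 2 * s + ∑ k, (a k : ℝ) * (if x ≤ g k then g k else ψ (g k))) :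
    x ≤ TERM[s, a, g, j] := by
  by_cases hs : j + 1 ≤ s
  · rw [term_eq_one_of_sure s a g j hs]; exact hx1
  have hsj : s ≤ j := by omega
  rw [term_shift s a g j hsj]
  refine hD κ a g (j - s) hg hlight ?_
  rw [Nat.cast_sub hsj]
  linarith

/-- **γ with capping — light giants shrunk.**  If `DIBWith x ψ` holds, gates are in `[0,1]`, `x ≤ 1`, and
`2j < 2s + Σ_k ecr k` with the EFFECTIVE credit `ecr k = a k·g k` (heavy, `x ≤ g k`) and
`ecr k = min(a k, j − s)·max(ψ(g k), 0)` (light), then `x ≤ TERM[s, a, g, j]`: shrink every light blob to size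
`min(a k, j − s)` (to `0` if its rate is `≤ 0`), which lowers the term (`term_mono_sizes`) and meets the size hypothesis
(ARCH-TREES-G49 §2.4 γ). [this work] -/
theorem term_ge_of_dibWith_capped {x : ℝ} {ψ : ℝ → ℝ} (hD : IndepBlob.DIBWith x ψ) (s : ℕ) (a : κ → ℕ) (g : κ → ℝ)
    (j : ℕ) (hx1 : x ≤ 1) (hg : ∀ k, 0 ≤ g k ∧ g k ≤ 1)
    (hbudget : (2 * j : ℝ) < 2 * s + ∑ k, (if x ≤ g k then (a k : ℝ) * g k
      else ((min (a k) (j - s) : ℕ) : ℝ) * max (ψ (g k)) 0)) : x ≤ TERM[s, a, g, j] := by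
  -- the shrunk sizes
  set a' : κ → ℕ := fun k => if x ≤ g k then a k else (if 0 < ψ (g k) then min (a k) (j - s) else 0) with ha'
  have hle : ∀ k, a' k ≤ a k := by
    intro k
    simp only [ha']
    split_ifs
    · exact le_refl _
    · exact Nat.min_le_left _ _
    · exact Nat.zero_le _
  refine le_trans ?_ (term_mono_sizes s a' a g j hg hle)
  refine term_ge_of_dibWith hD s a' g j hx1 hg (fun k hk => ?_) ?_
  · simp only [ha']
    rw [if_neg (not_le.2 hk)]
    split_ifs
    · exact Nat.min_le_right _ _
    · exact Nat.zero_le _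
  · refine hbudget.trans_le (le_of_eq ?_)
    congr 1
    refine Finset.sum_congr rfl fun k _ => ?_
    simp only [ha']
    by_cases hk : x ≤ g k
    · rw [if_pos hk, if_pos hk, if_pos hk]
    · rw [if_neg hk, if_neg hk, if_neg hk]
      by_cases hpos : 0 < ψ (g k)
      · rw [if_pos hpos, max_eq_left hpos.le]
      · rw [if_neg hpos, max_eq_right (not_lt.1 hpos), Nat.cast_zero, mul_zero, zero_mul]

/-- **Conditioning on one blob**: `TERM[s, a, g, j] = g k·TERM[s + a k, a[k ↦ 0], g, j] + (1 − g k)·TERM[s, a[k ↦ 0], g, j]`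
(a blob of size `0` is inert).  Rule δ of ARCH-TREES-G49 §2.4 (a LIGHT giant `s + a k ≥ j+1`: the first term is `g k`, so it
remains to certify the rest at the lower floor `(x − g k)/(1 − g k)`) is this identity plus `term_eq_one_of_sure`. [this work] -/
theorem term_cond (s : ℕ) (a : κ → ℕ) (g : κ → ℝ) (j : ℕ) (k : κ) :
    TERM[s, a, g, j] = g k * TERM[s + a k, Function.update a k 0, g, j] + (1 - g k) * TERM[s, Function.update a k 0, g, j] := by
  -- split every sum over `W` into `W ∌ k` and `insert k W`
  have hpow : ∀ (F : Finset κ → ℝ), ∑ W : Finset κ, F W =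
      ∑ W ∈ (Finset.univ.erase k).powerset, F W + ∑ W ∈ (Finset.univ.erase k).powerset, F (insert k W) := by
    intro F
    rw [← Finset.sum_powerset_insert (Finset.notMem_erase k Finset.univ), Finset.insert_erase (Finset.mem_univ k),
      Finset.powerset_univ]
  -- the weights of `W` and `insert k W` for `k ∉ W`
  have hw1 : ∀ W : Finset κ, k ∉ W → wt[g, W] = (1 - g k) * ∏ i ∈ Finset.univ.erase k, (if i ∈ W then g i else 1 - g i) := by
    intro W hkW
    rw [← Finset.mul_prod_erase Finset.univ (fun i => if i ∈ W then g i else 1 - g i) (Finset.mem_univ k), if_neg hkW]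
  have hw2 : ∀ W : Finset κ, k ∉ W →
      wt[g, insert k W] = g k * ∏ i ∈ Finset.univ.erase k, (if i ∈ W then g i else 1 - g i) := by
    intro W hkW
    rw [← Finset.mul_prod_erase Finset.univ (fun i => if i ∈ insert k W then g i else 1 - g i) (Finset.mem_univ k),
      if_pos (Finset.mem_insert_self k W)]
    congr 1
    refine Finset.prod_congr rfl fun i hi => ?_
    have hik : i ≠ k := Finset.ne_of_mem_erase hi
    simp only [Finset.mem_insert, hik, false_or]
  rw [hpow (fun W => wt[g, W] * (if j + 1 ≤ s + ∑ i ∈ W, a i then (1 : ℝ) else 0)),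
    hpow (fun W => wt[g, W] * (if j + 1 ≤ (s + a k) + ∑ i ∈ W, Function.update a k 0 i then (1 : ℝ) else 0)),
    hpow (fun W => wt[g, W] * (if j + 1 ≤ s + ∑ i ∈ W, Function.update a k 0 i then (1 : ℝ) else 0)),
    ← Finset.sum_add_distrib, ← Finset.sum_add_distrib, ← Finset.sum_add_distrib, Finset.mul_sum, Finset.mul_sum,
    ← Finset.sum_add_distrib]
  refine Finset.sum_congr rfl fun W hW => ?_
  have hkW : k ∉ W := fun h => Finset.notMem_erase k Finset.univ (Finset.mem_powerset.1 hW h)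
  -- the masses
  have hm0 : ∑ i ∈ W, Function.update a k 0 i = ∑ i ∈ W, a i :=
    Finset.sum_congr rfl fun i hi => by rw [Function.update_of_ne (ne_of_mem_of_not_mem hi hkW)]
  have hm1 : ∑ i ∈ insert k W, Function.update a k 0 i = ∑ i ∈ W, a i := by
    rw [Finset.sum_insert hkW, Function.update_self, zero_add, hm0]
  have hm2 : ∑ i ∈ insert k W, a i = a k + ∑ i ∈ W, a i := Finset.sum_insert hkW
  rw [hm0, hm1, hm2, hw1 W hkW, hw2 W hkW, ← add_assoc]
  split_ifs <;> ring

/-- **ε — Cantelli.**  Gates in `[0,1]`, `s ≤ j`, `m = Σ a g` and `V = Σ a² g (1 − g)` the mean and variance of the blob count,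
`j − s < m`: then `1 − V/(V + (m − (j − s))²) ≤ TERM[s, a, g, j]` (census-1 g14's `IndepBlob.count_cantelli`). [this work] -/
theorem term_ge_of_cantelli (s : ℕ) (a : κ → ℕ) (g : κ → ℝ) (j : ℕ) (hg : ∀ k, 0 ≤ g k ∧ g k ≤ 1) (hs : s ≤ j)
    (hj : ((j - s : ℕ) : ℝ) < ∑ k, (a k : ℝ) * g k) :
    1 - (∑ k, (a k : ℝ) ^ 2 * g k * (1 - g k)) /
        ((∑ k, (a k : ℝ) ^ 2 * g k * (1 - g k)) + ((∑ k, (a k : ℝ) * g k) - ((j - s : ℕ) : ℝ)) ^ 2) ≤ TERM[s, a, g, j] := by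
  rw [term_eq_one_sub s a g j hs]
  have key := IndepBlob.count_cantelli g (fun k => (a k : ℝ)) (fun k => (hg k).1) (fun k => (hg k).2) ((j - s : ℕ) : ℝ) hj
  have hfilt : (Finset.univ : Finset (Finset κ)).filter (fun W => ∑ k ∈ W, (a k : ℝ) ≤ ((j - s : ℕ) : ℝ)) =
      (Finset.univ : Finset (Finset κ)).filter (fun W => ∑ k ∈ W, a k ≤ j - s) := by
    ext W
    simp only [Finset.mem_filter, Finset.mem_univ, true_and]
    rw [← Nat.cast_sum, Nat.cast_le]
  rw [hfilt] at key
  linarith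

/-! ### 3. The conditional root row -/

/-- **R3 — THE CONDITIONAL ROOT ROW (`DEC-certificate ∧ DIB ⟹ FAR at the root`).**  Assume `DIBWith x ψ` (`x ≤ 1`; e.g.
`DIBStar x` or `DIBPsi x` via `.dibWith`).
Structure laws `μ k = Σ_r λ k r · TP[lo k r, hi k r, g k r]` (`λ ≥ 0`, `Σ_r λ = 1`, `lo ≤ hi ≤ M k`, genuine gates in `[0,1]`),
and for every GENUINE choice function `σ` (all `λ k (σ k) > 0`), writing `s = Σ_k lo k (σ k)`, `a k = (hi − lo) k (σ k)`,
`g k = g k (σ k)`, one of: (β) `j + 1 ≤ s`; (α) some blob has `x ≤ g k` and `j + 1 ≤ s + a k`; (γ) the effective discounted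
credit exceeds `2(j − s)`: `2j < 2s + Σ_k [a k·g k if x ≤ g k, else min(a k, j − s)·max(ψ(g k), 0)]`.
Then `x ≤ RTAIL[M, μ, j]`.  (ARCH-TREES-G49 §2.4–2.5 in product form; ε-certificates can be fed through
`rtail_ge_of_terms` + `term_ge_of_cantelli` directly.) [this work] -/
theorem rtail_ge_of_decCert {ρ : Type*} [Fintype ρ] [DecidableEq ρ] {x : ℝ} {ψ : ℝ → ℝ} (hD : IndepBlob.DIBWith x ψ)
    (M : κ → ℕ) (μ : κ → ℕ → ℝ) (lam : κ → ρ → ℝ) (lo hi : κ → ρ → ℕ) (g : κ → ρ → ℝ) (j : ℕ)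
    (hx1 : x ≤ 1) (hlam0 : ∀ k r, 0 ≤ lam k r) (hlam1 : ∀ k, ∑ r, lam k r = 1)
    (hμ : ∀ k h, μ k h = ∑ r, lam k r * TP[lo k r, hi k r, g k r, h])
    (hlohi : ∀ k r, lo k r ≤ hi k r) (hhi : ∀ k r, hi k r ≤ M k)
    (hg : ∀ k r, 0 < lam k r → 0 ≤ g k r ∧ g k r ≤ 1)
    (hcert : ∀ σ : κ → ρ, (∀ k, 0 < lam k (σ k)) →
      (j + 1 ≤ ∑ k, lo k (σ k)) ∨
      (∃ k, x ≤ g k (σ k) ∧ j + 1 ≤ (∑ k', lo k' (σ k')) + (hi k (σ k) - lo k (σ k))) ∨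
      ((2 * j : ℝ) < 2 * ((∑ k, lo k (σ k) : ℕ) : ℝ) + ∑ k, (if x ≤ g k (σ k)
        then ((hi k (σ k) - lo k (σ k) : ℕ) : ℝ) * g k (σ k)
        else ((min (hi k (σ k) - lo k (σ k)) (j - ∑ k', lo k' (σ k')) : ℕ) : ℝ) *
          max (ψ (g k (σ k))) 0))) :
    x ≤ RTAIL[M, μ, j] := by
  refine rtail_ge_of_terms M μ lam lo hi g hlam0 hlam1 hμ hlohi hhi j x fun σ hpos => ?_
  have hgσ : ∀ k, 0 ≤ g k (σ k) ∧ g k (σ k) ≤ 1 := fun k => hg k (σ k) (hpos k)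
  rcases hcert σ hpos with hβ | ⟨k, hxk, hk⟩ | hγ
  · rw [term_eq_one_of_sure _ _ _ j hβ]; exact hx1
  · exact hxk.trans (gate_le_term_of_giant _ _ _ j hgσ k hk)
  · exact term_ge_of_dibWith_capped hD _ _ _ j hx1 hgσ hγ

/-! ### 4. Linearity in one structure (the socket for sequential expansion) -/

/-- **Linearity of the root tail in ONE structure law.**  If `μ k₀ = Σ_r λ r · ν r` then
`RTAIL[M, μ, j] = Σ_r λ r · RTAIL[M, μ[k₀ ↦ ν r], j]`: ARCH-TREES-G49 §2.3 expands the structures one at a time, the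
decomposition of the next structure being allowed to depend on the components already chosen (through the sure mass
placed so far); iterate this lemma along any such strategy and finish each leaf with `rtail_twoPoint_eq_term` and a term
certificate. [this work] -/
theorem rtail_update_linear {ρ : Type*} [Fintype ρ] (M : κ → ℕ) (μ : κ → ℕ → ℝ) (k₀ : κ) (lam : ρ → ℝ)
    (ν : ρ → ℕ → ℝ) (hμ : ∀ h, μ k₀ h = ∑ r, lam r * ν r h) (j : ℕ) :
    RTAIL[M, μ, j] = ∑ r, lam r * RTAIL[M, Function.update μ k₀ (ν r), j] := by
  -- split the product at `k₀`
  have hsplit : ∀ (φ : κ → ℕ → ℝ) (c : κ → ℕ), (∏ k, φ k (c k)) = φ k₀ (c k₀) * ∏ k ∈ Finset.univ.erase k₀, φ k (c k) :=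
    fun φ c => (Finset.mul_prod_erase Finset.univ (fun k => φ k (c k)) (Finset.mem_univ k₀)).symm
  have hrest : ∀ (r : ρ) (c : κ → ℕ), ∏ k ∈ Finset.univ.erase k₀, Function.update μ k₀ (ν r) k (c k) =
      ∏ k ∈ Finset.univ.erase k₀, μ k (c k) :=
    fun r c => Finset.prod_congr rfl fun k hk => by rw [Function.update_of_ne (Finset.ne_of_mem_erase hk)]
  have h1 : ∀ c : κ → ℕ, (∏ k, μ k (c k)) = ∑ r, lam r * ∏ k, Function.update μ k₀ (ν r) k (c k) := by
    intro c
    rw [hsplit μ c, hμ, Finset.sum_mul]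
    refine Finset.sum_congr rfl fun r _ => ?_
    rw [hsplit (Function.update μ k₀ (ν r)) c, hrest r c, Function.update_self, mul_assoc]
  calc RTAIL[M, μ, j]
      = ∑ c ∈ cfg[M], ∑ r, lam r * ((∏ k, Function.update μ k₀ (ν r) k (c k)) *
          (if j + 1 ≤ ∑ k, c k then (1 : ℝ) else 0)) := by
        refine Finset.sum_congr rfl fun c _ => ?_
        rw [h1 c, Finset.sum_mul]
        exact Finset.sum_congr rfl fun r _ => by ring
    _ = ∑ r, ∑ c ∈ cfg[M], lam r * ((∏ k, Function.update μ k₀ (ν r) k (c k)) *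
          (if j + 1 ≤ ∑ k, c k then (1 : ℝ) else 0)) := Finset.sum_comm
    _ = ∑ r, lam r * RTAIL[M, Function.update μ k₀ (ν r), j] :=
        Finset.sum_congr rfl fun r _ => by rw [Finset.mul_sum]

end RootDec

end Quant

end Summit.CriticalPhenomena.PercolationContinuityZ3.Theorems
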